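import Literature.Probability.Distributions.BrascampLiebMomentAux

/-!
# Brascamp–Lieb 1976, Theorem 5.1 (n = 1) — the mean-zero, quasi-concave core

`Literature/Probability/Distributions/`. The heart of the one-dimensional case of Brascamp–Lieb's
moment inequality (J. Funct. Anal. 22 (1976) Thm 5.1 = Lemma 5.3): if `G ≥ 0` is quasi-concave
(`min (G x) (G z) ≤ G y` for `x ≤ y ≤ z`), all moments of `x^k e^{-bx²} G` are integrable and
`∫ x e^{-bx²} G(x) dx = 0`, then for every integer `p ≥ 1`

  `M_0(b) · ∫ |x|^p e^{-bx²} G ≤ M_p(b) · ∫ e^{-bx²} G`,   `M_p(b) = ∫_{(0,∞)} x^p e^{-bx²}`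

(`GaussQCData.core`), i.e. `⟨|x|^p⟩_G ≤ ⟨|x|^p⟩_1` in the paper's notation. In the printed proof
this is Lemma 5.3 after the recentring `G(x) = F(x + ⟨x⟩_F) e^{-2x⟨x⟩_F}` (done in
`BrascampLiebMomentInequality`); log-concavity of `F` is used only through the quasi-concavity of
`G`. The printed argument (`G ∈ C¹` by approximation, a mode `K ≥ 0`, (5.6)–(5.7)
`∫_0^∞ e^{-x²} G' ≤ 0`, Chebyshev (5.3)–(5.4) for the `G(−x)` half, and (5.9)–(5.11) for the `G(x)`
half via the increasing function `ψ`) is followed step by step in a derivative-free form that needs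
no approximation: quasi-concavity gives "`G` non-decreasing on `(−∞,0]` or non-increasing on
`[0,∞)`" (reflect in the second case); (5.6)–(5.7) become the pointwise tail inequalities
`2b ∫_{(s,∞)} y e^{-by²} G ≤ G(s) e^{-bs²}` (`tail_le`); and (5.9)–(5.11) become one Tonelli
interchange against `ψ_p' = λ_p ≥ 0` (`setIntegral_Ioi_sub_blC_mul_nonpos`). No named facts.

References: H. J. Brascamp, E. H. Lieb, J. Funct. Anal. 22 (1976) 366–389, §5. [BrascampLieb1976]
-/

noncomputable section

open MeasureTheory Set Filter Real
open scoped Topology ENNReal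

namespace Literature.Probability.Distributions

/-! ### Hypothesis structure for the mean-zero core -/

/-- Data of the mean-zero core of Brascamp–Lieb's Theorem 5.1 (`n = 1`): a nonnegative
quasi-concave function `G` (every value between two points is at least the smaller endpoint value —
this, for `G` and for its exponential tilts, is all that log-concavity of the perturbing factor is
used for), all moments of `x ↦ x^k e^{-bx²} G(x)` integrable, and `∫ x e^{-bx²} G(x) dx = 0`.
[cite: BrascampLieb1976, Lemma 5.3 (the function `G` of its proof)] -/
structure GaussQCData (b : ℝ) (G : ℝ → ℝ) : Prop where
  /-- `G ≥ 0`. -/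
  nonneg : ∀ x, 0 ≤ G x
  /-- Quasi-concavity: between two points `G` is at least the smaller endpoint value. -/
  quasiconcave : ∀ ⦃x y z : ℝ⦄, x ≤ y → y ≤ z → min (G x) (G z) ≤ G y
  /-- All moments of `x^k e^{-bx²} G(x)` are integrable. -/
  integrable : ∀ k : ℕ, Integrable fun x => x ^ k * (Real.exp (-b * x ^ 2) * G x)
  /-- The mean of `e^{-bx²} G` vanishes (`⟨x⟩_G = 0`). -/
  mean_zero : ∫ x, x * (Real.exp (-b * x ^ 2) * G x) = 0

namespace GaussQCData

variable {b : ℝ} {G : ℝ → ℝ}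

/-- `e^{-bx²} G` is integrable. [cite: BrascampLieb1976, Lemma 5.3] -/
theorem integrable_gauss_mul (D : GaussQCData b G) :
    Integrable fun x => Real.exp (-b * x ^ 2) * G x := by simpa using D.integrable 0

/-- `x e^{-bx²} G` is integrable. [cite: BrascampLieb1976, Lemma 5.3] -/
theorem integrable_id_mul (D : GaussQCData b G) :
    Integrable fun x => x * (Real.exp (-b * x ^ 2) * G x) := by simpa using D.integrable 1

/-- `e^{-bx²} G` is a.e. strongly measurable. [cite: BrascampLieb1976, Lemma 5.3] -/
theorem aestronglyMeasurable_gauss_mul (D : GaussQCData b G) :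
    AEStronglyMeasurable (fun x => Real.exp (-b * x ^ 2) * G x) volume :=
  D.integrable_gauss_mul.aestronglyMeasurable

/-- Reflection `x ↦ G(-x)` preserves the data (the printed "we can assume that `K ≥ 0`, say").
[cite: BrascampLieb1976, Lemma 5.3] -/
theorem comp_neg (D : GaussQCData b G) : GaussQCData b (fun x => G (-x)) where
  nonneg x := D.nonneg (-x)
  quasiconcave x y z hxy hyz := by
    have h := D.quasiconcave (neg_le_neg hyz) (neg_le_neg hxy)
    rwa [min_comm] at h
  integrable k := by
    have h := ((D.integrable k).comp_neg).const_mul ((-1 : ℝ) ^ k)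
    refine h.congr (Filter.Eventually.of_forall fun x => ?_)
    have h1 : ((-1 : ℝ) ^ k) * ((-1 : ℝ) ^ k) = 1 := by
      rw [← mul_pow]; norm_num
    dsimp only
    rw [neg_pow x, neg_sq]
    linear_combination (x ^ k * (Real.exp (-b * x ^ 2) * G (-x))) * h1
  mean_zero := by
    have h := integral_neg_eq_self (fun x : ℝ => x * (Real.exp (-b * x ^ 2) * G x)) volume
    rw [D.mean_zero] at h
    have e : (fun x : ℝ => x * (Real.exp (-b * x ^ 2) * G (-x))) =
        fun x => -((-x) * (Real.exp (-b * (-x) ^ 2) * G (-x))) := by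
      funext x; simp only [neg_sq]; ring
    rw [e, integral_neg, h, neg_zero]

/-- A quasi-concave function is non-decreasing on `(-∞, 0]` or non-increasing on `[0, ∞)` (the printed
"`G` is increasing for `x < K`; decreasing for `x > K`", without naming a mode `K`). [cite: BrascampLieb1976, Lemma 5.3] -/
theorem mono_or_anti (D : GaussQCData b G) :
    (∀ ⦃x y : ℝ⦄, x ≤ y → y ≤ 0 → G x ≤ G y) ∨ (∀ ⦃x y : ℝ⦄, 0 ≤ x → x ≤ y → G y ≤ G x) := by
  by_contra h
  push Not at h
  obtain ⟨⟨x, y, hxy, hy0, hGxy⟩, ⟨u, v, hu0, huv, hGuv⟩⟩ := h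
  have h1 := D.quasiconcave hxy (hy0.trans (hu0.trans huv))
  have h2 := D.quasiconcave (hxy.trans (hy0.trans hu0)) huv
  rcases min_le_iff.mp h1 with h | h
  · linarith
  · rcases min_le_iff.mp h2 with h' | h' <;> linarith

/-- **The tail inequality** ((5.6)–(5.7) of the printed proof, derivative-free): if moreover `G` is
non-decreasing on `(-∞, 0]`, then for every `s ≥ 0`,
`2b ∫_{(s,∞)} y e^{-by²} G(y) dy ≤ G(s) e^{-bs²}`. [cite: BrascampLieb1976, Lemma 5.3 (5.6)–(5.7)] -/
theorem tail_le (hb : 0 < b) (D : GaussQCData b G)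
    (hmono : ∀ ⦃x y : ℝ⦄, x ≤ y → y ≤ 0 → G x ≤ G y) {s : ℝ} (hs : 0 ≤ s) :
    2 * b * ∫ y in Ioi s, y * (Real.exp (-b * y ^ 2) * G y) ≤ G s * Real.exp (-b * s ^ 2) := by
  have hI : Integrable fun y : ℝ => y * (Real.exp (-b * y ^ 2) * G y) := D.integrable_id_mul
  have hIB : Integrable fun y : ℝ => y * (Real.exp (-b * y ^ 2) * G (-y)) := D.comp_neg.integrable_id_mul
  have hIw : Integrable fun y : ℝ => y * Real.exp (-b * y ^ 2) := integrable_mul_exp_neg_mul_sq hb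
  -- folded mean zero: `∫_{(0,∞)} y w G(y) = ∫_{(0,∞)} y w G(-y)`
  have hsplit := intervalIntegral.integral_Iic_add_Ioi (b := (0:ℝ)) hI.integrableOn hI.integrableOn
  rw [D.mean_zero] at hsplit
  have hrefl : ∫ y in Iic (0:ℝ), y * (Real.exp (-b * y ^ 2) * G y) =
      -∫ y in Ioi (0:ℝ), y * (Real.exp (-b * y ^ 2) * G (-y)) := by
    have h := integral_comp_neg_Ioi 0 (fun y : ℝ => y * (Real.exp (-b * y ^ 2) * G y))
    rw [neg_zero] at h
    rw [← h, ← integral_neg]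
    refine setIntegral_congr_fun measurableSet_Ioi fun y _ => ?_
    simp only [neg_sq]; ring
  have hAB : ∫ y in Ioi (0:ℝ), y * (Real.exp (-b * y ^ 2) * G y) =
      ∫ y in Ioi (0:ℝ), y * (Real.exp (-b * y ^ 2) * G (-y)) := by linarith
  -- `∫_{(0,∞)} y w G(-y) ≤ G(0)/(2b)`
  have hB : ∫ y in Ioi (0:ℝ), y * (Real.exp (-b * y ^ 2) * G (-y)) ≤
      G 0 * ∫ y in Ioi (0:ℝ), y * Real.exp (-b * y ^ 2) := by
    rw [← integral_const_mul]
    refine setIntegral_mono_on hIB.integrableOn (hIw.const_mul _).integrableOn measurableSet_Ioi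
      fun y hy => ?_
    have hy0 : 0 ≤ y := le_of_lt hy
    have hG : G (-y) ≤ G 0 := hmono (by linarith) le_rfl
    have hw : 0 ≤ y * Real.exp (-b * y ^ 2) := by positivity
    nlinarith
  rw [setIntegral_Ioi_id_mul_gauss hb 0] at hB
  have hA : 2 * b * ∫ y in Ioi (0:ℝ), y * (Real.exp (-b * y ^ 2) * G y) ≤ G 0 := by
    rw [hAB]
    have h := mul_le_mul_of_nonneg_left hB (by positivity : (0:ℝ) ≤ 2 * b)
    have e : 2 * b * (G 0 * (Real.exp (-b * (0:ℝ) ^ 2) / (2 * b))) = G 0 := by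
      field_simp; simp
    linarith
  have hws : 0 < Real.exp (-b * s ^ 2) := Real.exp_pos _
  by_cases hcase : G 0 ≤ G s
  · -- `G ≥ G(0)` on `[0, s]`
    have hsub := intervalIntegral.integral_Ioi_sub_Ioi hI.integrableOn hs
    have hsub' := intervalIntegral.integral_Ioi_sub_Ioi hIw.integrableOn hs
    rw [setIntegral_Ioi_id_mul_gauss hb 0, setIntegral_Ioi_id_mul_gauss hb s] at hsub'
    have hlow : G 0 * ∫ y in (0:ℝ)..s, y * Real.exp (-b * y ^ 2) ≤
        ∫ y in (0:ℝ)..s, y * (Real.exp (-b * y ^ 2) * G y) := by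
      rw [← intervalIntegral.integral_const_mul]
      refine intervalIntegral.integral_mono_on hs ((hIw.const_mul _).intervalIntegrable)
        hI.intervalIntegrable fun y hy => ?_
      have hG : G 0 ≤ G y := by simpa [min_eq_left hcase] using D.quasiconcave hy.1 hy.2
      have hw : 0 ≤ y * Real.exp (-b * y ^ 2) := by have := hy.1; positivity
      nlinarith
    have e0 : Real.exp (-b * (0:ℝ) ^ 2) = 1 := by simp
    rw [e0] at hsub'
    have h2b : (0:ℝ) < 2 * b := by positivity
    calc 2 * b * ∫ y in Ioi s, y * (Real.exp (-b * y ^ 2) * G y)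
        = 2 * b * (∫ y in Ioi (0:ℝ), y * (Real.exp (-b * y ^ 2) * G y)) -
            2 * b * ∫ y in (0:ℝ)..s, y * (Real.exp (-b * y ^ 2) * G y) := by rw [← hsub]; ring
      _ ≤ G 0 - 2 * b * (G 0 * ∫ y in (0:ℝ)..s, y * Real.exp (-b * y ^ 2)) := by
            linarith [mul_le_mul_of_nonneg_left hlow h2b.le]
      _ = G 0 * Real.exp (-b * s ^ 2) := by
            rw [← hsub']; field_simp; ring
      _ ≤ G s * Real.exp (-b * s ^ 2) := mul_le_mul_of_nonneg_right hcase hws.le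
  · push Not at hcase
    have hdec : ∀ y ∈ Ioi s, y * (Real.exp (-b * y ^ 2) * G y) ≤
        G s * (y * Real.exp (-b * y ^ 2)) := by
      intro y hy
      have hy' : s < y := hy
      have hGy : G y ≤ G s := by
        rcases min_le_iff.mp (D.quasiconcave hs hy'.le) with h | h
        · exact absurd h (not_le.mpr hcase)
        · exact h
      have hy0 : 0 ≤ y := hs.trans hy'.le
      have hw : 0 ≤ y * Real.exp (-b * y ^ 2) := by positivity
      nlinarith
    have hle := setIntegral_mono_on hI.integrableOn (hIw.const_mul _).integrableOn
      measurableSet_Ioi hdec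
    rw [integral_const_mul, setIntegral_Ioi_id_mul_gauss hb s] at hle
    calc 2 * b * ∫ y in Ioi s, y * (Real.exp (-b * y ^ 2) * G y)
        ≤ 2 * b * (G s * (Real.exp (-b * s ^ 2) / (2 * b))) :=
          mul_le_mul_of_nonneg_left hle (by positivity)
      _ = G s * Real.exp (-b * s ^ 2) := by field_simp

/-- **The right half-line** ((5.9)–(5.11) of the printed proof): under the hypotheses of `tail_le`,
`∫_{(0,∞)} (y^p − c_p) e^{-by²} G(y) dy ≤ 0`, i.e. the Gaussian-weighted covariance of `y^p` and `G`
on `(0, ∞)` is `≤ 0`. Proof: `y^p − c_p = 2by ψ_p(y) − λ_p(y)` with `ψ_p = ∫_0^· λ_p`, `λ_p ≥ 0`;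
one Tonelli interchange turns `∫ 2by ψ_p e^{-by²} G` into `∫ λ_p(s) · 2b∫_{(s,∞)} y e^{-by²}G ds`,
which `tail_le` bounds by `∫ λ_p e^{-bs²} G`. [cite: BrascampLieb1976, Lemma 5.3 (5.9)–(5.11)] -/
theorem setIntegral_Ioi_sub_blC_mul_nonpos (hb : 0 < b) {p : ℕ} (hp : p ≠ 0)
    (D : GaussQCData b G) (hmono : ∀ ⦃x y : ℝ⦄, x ≤ y → y ≤ 0 → G x ≤ G y) :
    ∫ y in Ioi (0:ℝ), (y ^ p - blC b p) * (Real.exp (-b * y ^ 2) * G y) ≤ 0 := by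
  set c := blC b p with hc
  set ψ := blPsi b p with hψ
  set lam := blLam b p with hlam
  set WG : ℝ → ℝ := fun y => Real.exp (-b * y ^ 2) * G y with hWG
  have hWGnn : ∀ y, 0 ≤ WG y := fun y => mul_nonneg (Real.exp_pos _).le (D.nonneg y)
  have hWGm : AEStronglyMeasurable WG volume := D.aestronglyMeasurable_gauss_mul
  have hψnn : ∀ y, 0 ≤ y → 0 ≤ ψ y := fun y hy => blPsi_nonneg hb hp hy
  have hlamnn : ∀ y, 0 ≤ y → 0 ≤ lam y := fun y hy => blLam_nonneg hb hp hy
  -- integrability of the three pieces on `(0, ∞)`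
  have hIp : IntegrableOn (fun y => (y ^ p - c) * WG y) (Ioi 0) := by
    have e : (fun y => (y ^ p - c) * WG y) = fun y => y ^ p * WG y - c * WG y := by
      funext y; ring
    rw [e]; exact ((D.integrable p).sub (D.integrable_gauss_mul.const_mul c)).integrableOn
  have hIψ : IntegrableOn (fun y => 2 * b * y * ψ y * WG y) (Ioi 0) := by
    have hdom : IntegrableOn (fun y => 2 * b * (2 ^ p * (gaussHalfMoment b p * (y * WG y) +
        gaussHalfMoment b 0 * (y ^ (p + 1) * WG y)))) (Ioi 0) :=
      (((D.integrable_id_mul.const_mul _).add ((D.integrable (p + 1)).const_mul _)).const_mul _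
        |>.const_mul _).integrableOn
    refine Integrable.mono' hdom ?_ ?_
    · have hcψ : Continuous fun y : ℝ => 2 * b * y * ψ y := by
        have := continuous_blPsi b p; fun_prop
      exact (hcψ.aestronglyMeasurable.mul hWGm).restrict
    · refine (ae_restrict_iff' measurableSet_Ioi).2 (Filter.Eventually.of_forall fun y hy => ?_)
      have hy0 : 0 ≤ y := le_of_lt hy
      have h1 := hψnn y hy0
      have h2 := blPsi_le hb p hy0
      have h3 := hWGnn y
      have hnn : 0 ≤ 2 * b * y * ψ y * WG y := by positivity
      rw [Real.norm_of_nonneg hnn]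
      calc 2 * b * y * ψ y * WG y
          ≤ 2 * b * y * (2 ^ p * (gaussHalfMoment b p + gaussHalfMoment b 0 * y ^ p)) * WG y := by
            gcongr
        _ = 2 * b * (2 ^ p * (gaussHalfMoment b p * (y * WG y) +
              gaussHalfMoment b 0 * (y ^ (p + 1) * WG y))) := by ring
  have elam : ∀ y, lam y * WG y = 2 * b * y * ψ y * WG y - (y ^ p - c) * WG y := by
    intro y; simp only [hlam, blLam, hψ, hc]; ring
  have hIlam : IntegrableOn (fun y => lam y * WG y) (Ioi 0) := by
    have e : (fun y => lam y * WG y) = fun y => 2 * b * y * ψ y * WG y - (y ^ p - c) * WG y :=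
      funext elam
    rw [e]; exact hIψ.sub hIp
  have hIsWG : ∀ s : ℝ, IntegrableOn (fun y => 2 * b * y * WG y) (Ioi s) := fun s => by
    have e : (fun y => 2 * b * y * WG y) = fun y => (2 * b) * (y * WG y) := by funext y; ring
    rw [e]; exact (D.integrable_id_mul.const_mul _).integrableOn
  -- the Tonelli step: `∫ 2by ψ WG ≤ ∫ λ WG`
  have hmain : ∫ y in Ioi (0:ℝ), 2 * b * y * ψ y * WG y ≤ ∫ s in Ioi (0:ℝ), lam s * WG s := by
    have hP : ∀ y, 0 ≤ y → 0 ≤ 2 * b * y * WG y := fun y hy => by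
      have := hWGnn y; positivity
    -- the kernel
    set K : ℝ → ℝ → ℝ≥0∞ := fun y s => (Iic y).indicator
      (fun s => ENNReal.ofReal (2 * b * y * WG y) * ENNReal.ofReal (lam s)) s with hK
    -- (i) the left side as an iterated lintegral
    have hψrep : ∀ y ∈ Ioi (0:ℝ), ENNReal.ofReal (ψ y) = ∫⁻ s in Ioc 0 y, ENNReal.ofReal (lam s) := by
      intro y hy
      have hy0 : 0 ≤ y := le_of_lt hy
      have e : ψ y = ∫ s in Ioc 0 y, lam s := by
        rw [hψ, blPsi_eq_integral_blLam, intervalIntegral.integral_of_le hy0]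
      rw [e]
      exact ofReal_integral_eq_lintegral_ofReal (continuous_blLam b p).integrableOn_Ioc
        ((ae_restrict_iff' measurableSet_Ioc).2 (Filter.Eventually.of_forall
          fun s hs => hlamnn s hs.1.le))
    have hK1 : ∀ y ∈ Ioi (0:ℝ),
        ENNReal.ofReal (2 * b * y * ψ y * WG y) = ∫⁻ s in Ioi (0:ℝ), K y s := by
      intro y hy
      have hy0 : 0 ≤ y := le_of_lt hy
      rw [show 2 * b * y * ψ y * WG y = (2 * b * y * WG y) * ψ y by ring,
        ENNReal.ofReal_mul (hP y hy0), hψrep y hy, ← lintegral_const_mul' _ _ ENNReal.ofReal_ne_top]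
      simp only [hK]
      rw [lintegral_indicator measurableSet_Iic, Measure.restrict_restrict measurableSet_Iic,
        inter_comm, Ioi_inter_Iic]
    have hL : ENNReal.ofReal (∫ y in Ioi (0:ℝ), 2 * b * y * ψ y * WG y) =
        ∫⁻ y in Ioi (0:ℝ), ∫⁻ s in Ioi (0:ℝ), K y s := by
      rw [ofReal_integral_eq_lintegral_ofReal hIψ ((ae_restrict_iff' measurableSet_Ioi).2
        (Filter.Eventually.of_forall fun y hy => by
          have h1 := hψnn y (le_of_lt hy); have h2 := hWGnn y; have h3 : 0 ≤ y := le_of_lt hy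
          positivity))]
      exact setLIntegral_congr_fun measurableSet_Ioi hK1
    -- (ii) measurability of the kernel on the product
    have hKm : AEMeasurable (Function.uncurry K)
        ((volume.restrict (Ioi (0:ℝ))).prod (volume.restrict (Ioi (0:ℝ)))) := by
      have h1 : AEMeasurable (fun z : ℝ × ℝ => ENNReal.ofReal (2 * b * z.1 * WG z.1))
          ((volume.restrict (Ioi (0:ℝ))).prod (volume.restrict (Ioi (0:ℝ)))) := by
        have h : AEStronglyMeasurable (fun y : ℝ => 2 * b * y * WG y) (volume.restrict (Ioi 0)) :=
          ((by fun_prop : Continuous fun y : ℝ => 2 * b * y).aestronglyMeasurable.mul hWGm).restrict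
        exact h.aemeasurable.ennreal_ofReal.comp_fst
      have h2 : AEMeasurable (fun z : ℝ × ℝ => ENNReal.ofReal (lam z.2))
          ((volume.restrict (Ioi (0:ℝ))).prod (volume.restrict (Ioi (0:ℝ)))) :=
        ((continuous_blLam b p).measurable.ennreal_ofReal.comp measurable_snd).aemeasurable
      have h3 : MeasurableSet {z : ℝ × ℝ | z.2 ≤ z.1} := measurableSet_le measurable_snd measurable_fst
      have e : Function.uncurry K = {z : ℝ × ℝ | z.2 ≤ z.1}.indicator
          (fun z => ENNReal.ofReal (2 * b * z.1 * WG z.1) * ENNReal.ofReal (lam z.2)) := by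
        funext z
        rcases z with ⟨y, s⟩
        simp only [Function.uncurry, hK, Set.indicator, mem_Iic, mem_setOf_eq]
      rw [e]; exact (h1.mul h2).indicator h3
    -- (iii) the inner integral after the interchange, bounded by `tail_le`
    have hK2 : ∀ s ∈ Ioi (0:ℝ), ∫⁻ y in Ioi (0:ℝ), K y s ≤ ENNReal.ofReal (lam s * WG s) := by
      intro s hs
      have hs0 : 0 ≤ s := le_of_lt hs
      have e1 : (fun y => K y s) = (Ici s).indicator
          (fun y => ENNReal.ofReal (2 * b * y * WG y) * ENNReal.ofReal (lam s)) := by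
        funext y; simp only [hK, Set.indicator, mem_Iic, mem_Ici]
      have e2 : Ici s ∩ Ioi (0:ℝ) = Ici s :=
        inter_eq_left.2 fun y hy => mem_Ioi.2 (lt_of_lt_of_le hs hy)
      rw [e1, lintegral_indicator measurableSet_Ici, Measure.restrict_restrict measurableSet_Ici, e2,
        lintegral_mul_const' _ _ ENNReal.ofReal_ne_top, setLIntegral_congr Ioi_ae_eq_Ici.symm,
        ← ofReal_integral_eq_lintegral_ofReal (hIsWG s) ((ae_restrict_iff' measurableSet_Ioi).2
          (Filter.Eventually.of_forall fun y hy => hP y (hs0.trans (le_of_lt hy)))),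
        ← ENNReal.ofReal_mul (setIntegral_nonneg measurableSet_Ioi
          fun y hy => hP y (hs0.trans (le_of_lt hy)))]
      refine ENNReal.ofReal_le_ofReal ?_
      have ht := D.tail_le hb hmono hs0
      have e3 : ∫ y in Ioi s, 2 * b * y * WG y = 2 * b * ∫ y in Ioi s, y * WG y := by
        rw [← integral_const_mul]; congr 1; funext y; ring
      rw [e3, mul_comm]
      have : 2 * b * ∫ y in Ioi s, y * WG y ≤ WG s := by
        simpa [hWG, mul_comm] using ht
      exact mul_le_mul_of_nonneg_left this (hlamnn s hs0)
    -- (iv) assemble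
    have hR : ∫⁻ s in Ioi (0:ℝ), ENNReal.ofReal (lam s * WG s) =
        ENNReal.ofReal (∫ s in Ioi (0:ℝ), lam s * WG s) :=
      (ofReal_integral_eq_lintegral_ofReal hIlam ((ae_restrict_iff' measurableSet_Ioi).2
        (Filter.Eventually.of_forall fun s hs => mul_nonneg (hlamnn s (le_of_lt hs)) (hWGnn s)))).symm
    have hRnn : 0 ≤ ∫ s in Ioi (0:ℝ), lam s * WG s :=
      setIntegral_nonneg measurableSet_Ioi fun s hs => mul_nonneg (hlamnn s (le_of_lt hs)) (hWGnn s)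
    have key : ENNReal.ofReal (∫ y in Ioi (0:ℝ), 2 * b * y * ψ y * WG y) ≤
        ENNReal.ofReal (∫ s in Ioi (0:ℝ), lam s * WG s) := by
      calc ENNReal.ofReal (∫ y in Ioi (0:ℝ), 2 * b * y * ψ y * WG y)
          = ∫⁻ y in Ioi (0:ℝ), ∫⁻ s in Ioi (0:ℝ), K y s := hL
        _ = ∫⁻ s in Ioi (0:ℝ), ∫⁻ y in Ioi (0:ℝ), K y s := lintegral_lintegral_swap hKm
        _ ≤ ∫⁻ s in Ioi (0:ℝ), ENNReal.ofReal (lam s * WG s) :=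
            lintegral_mono_ae ((ae_restrict_iff' measurableSet_Ioi).2
              (Filter.Eventually.of_forall hK2))
        _ = ENNReal.ofReal (∫ s in Ioi (0:ℝ), lam s * WG s) := hR
    exact (ENNReal.ofReal_le_ofReal_iff hRnn).1 key
  -- conclude
  have e : (fun y => (y ^ p - c) * WG y) = fun y => 2 * b * y * ψ y * WG y - lam y * WG y := by
    funext y; rw [elam]; ring
  change ∫ y in Ioi (0:ℝ), (y ^ p - c) * WG y ≤ 0
  rw [e, integral_sub hIψ hIlam]
  linarith

/-- Folding an integral over `ℝ` onto `(0, ∞)`. [folklore] -/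
private theorem integral_eq_setIntegral_Ioi_add {f : ℝ → ℝ} (hf : Integrable f) :
    ∫ x, f x = (∫ x in Ioi (0:ℝ), f x) + ∫ x in Ioi (0:ℝ), f (-x) := by
  rw [← intervalIntegral.integral_Iic_add_Ioi (b := (0:ℝ)) hf.integrableOn hf.integrableOn,
    add_comm, integral_comp_neg_Ioi 0 f, neg_zero]

/-- The core inequality when `G` is non-decreasing on `(-∞, 0]` (the printed case `K ≥ 0`):
`M_0 ∫ |x|^p e^{-bx²} G ≤ M_p ∫ e^{-bx²} G` — (5.8) = left half by Chebyshev + right half by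
`setIntegral_Ioi_sub_blC_mul_nonpos`. [cite: BrascampLieb1976, Lemma 5.3 eq. (5.8)] -/
theorem core_of_mono (hb : 0 < b) {p : ℕ} (hp : p ≠ 0) (D : GaussQCData b G)
    (hmono : ∀ ⦃x y : ℝ⦄, x ≤ y → y ≤ 0 → G x ≤ G y) :
    gaussHalfMoment b 0 * ∫ x, |x| ^ p * (Real.exp (-b * x ^ 2) * G x) ≤
      gaussHalfMoment b p * ∫ x, Real.exp (-b * x ^ 2) * G x := by
  have hM0 := gaussHalfMoment_pos hb 0
  have hMp := gaussHalfMoment_pos hb p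
  have D' := D.comp_neg
  -- integrability
  have hIabs : Integrable fun x => |x| ^ p * (Real.exp (-b * x ^ 2) * G x) := by
    refine (D.integrable p).congr' ?_ (Filter.Eventually.of_forall fun x => ?_)
    · exact ((continuous_abs.pow p).aestronglyMeasurable.mul D.aestronglyMeasurable_gauss_mul)
    · simp only [Real.norm_eq_abs, abs_mul, abs_pow, abs_abs]
  -- fold both integrals onto `(0, ∞)`
  have hf1 := integral_eq_setIntegral_Ioi_add hIabs
  have hf2 := integral_eq_setIntegral_Ioi_add D.integrable_gauss_mul
  have e1 : ∫ x in Ioi (0:ℝ), |x| ^ p * (Real.exp (-b * x ^ 2) * G x) =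
      ∫ x in Ioi (0:ℝ), x ^ p * (Real.exp (-b * x ^ 2) * G x) :=
    setIntegral_congr_fun measurableSet_Ioi fun x hx => by rw [abs_of_pos hx]
  have e2 : ∫ x in Ioi (0:ℝ), |-x| ^ p * (Real.exp (-b * (-x) ^ 2) * G (-x)) =
      ∫ x in Ioi (0:ℝ), x ^ p * (Real.exp (-b * x ^ 2) * G (-x)) :=
    setIntegral_congr_fun measurableSet_Ioi fun x hx => by rw [abs_neg, abs_of_pos hx, neg_sq]
  have e3 : ∫ x in Ioi (0:ℝ), Real.exp (-b * (-x) ^ 2) * G (-x) =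
      ∫ x in Ioi (0:ℝ), Real.exp (-b * x ^ 2) * G (-x) :=
    setIntegral_congr_fun measurableSet_Ioi fun x _ => by rw [neg_sq]
  rw [hf1, hf2, e1, e2, e3, mul_add, mul_add]
  -- right half-line: from the covariance inequality
  have hR : gaussHalfMoment b 0 * ∫ x in Ioi (0:ℝ), x ^ p * (Real.exp (-b * x ^ 2) * G x) ≤
      gaussHalfMoment b p * ∫ x in Ioi (0:ℝ), Real.exp (-b * x ^ 2) * G x := by
    have h := D.setIntegral_Ioi_sub_blC_mul_nonpos hb hp hmono
    have e : (fun y : ℝ => (y ^ p - blC b p) * (Real.exp (-b * y ^ 2) * G y)) = fun y =>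
        y ^ p * (Real.exp (-b * y ^ 2) * G y) - blC b p * (Real.exp (-b * y ^ 2) * G y) := by
      funext y; ring
    rw [e, integral_sub (D.integrable p).integrableOn (D.integrable_gauss_mul.const_mul _).integrableOn,
      integral_const_mul] at h
    have h' : (∫ x in Ioi (0:ℝ), x ^ p * (Real.exp (-b * x ^ 2) * G x)) ≤
        blC b p * ∫ x in Ioi (0:ℝ), Real.exp (-b * x ^ 2) * G x := by linarith
    calc gaussHalfMoment b 0 * ∫ x in Ioi (0:ℝ), x ^ p * (Real.exp (-b * x ^ 2) * G x)
        ≤ gaussHalfMoment b 0 * (blC b p * ∫ x in Ioi (0:ℝ), Real.exp (-b * x ^ 2) * G x) :=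
          mul_le_mul_of_nonneg_left h' hM0.le
      _ = gaussHalfMoment b p * ∫ x in Ioi (0:ℝ), Real.exp (-b * x ^ 2) * G x := by
          rw [← mul_assoc, mul_comm (gaussHalfMoment b 0), blC_mul_gaussHalfMoment_zero hb]
  -- left half-line: Chebyshev with the non-increasing function `x ↦ G(-x)`
  have hL : gaussHalfMoment b 0 * ∫ x in Ioi (0:ℝ), x ^ p * (Real.exp (-b * x ^ 2) * G (-x)) ≤
      gaussHalfMoment b p * ∫ x in Ioi (0:ℝ), Real.exp (-b * x ^ 2) * G (-x) :=
    gaussHalf_chebyshev hb hp (f := fun x => G (-x))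
      (fun x y hx hxy => hmono (neg_le_neg hxy) (by linarith))
      D'.integrable_gauss_mul.integrableOn (D'.integrable p).integrableOn
  linarith

/-- **The mean-zero core of Brascamp–Lieb's Theorem 5.1 (`n = 1`)**: for quasi-concave `G ≥ 0`
with `∫ x e^{-bx²} G = 0` and `p ≥ 1`, `M_0(b) ∫ |x|^p e^{-bx²} G ≤ M_p(b) ∫ e^{-bx²} G`, i.e.
`⟨|x|^p⟩_G ≤ ⟨|x|^p⟩_1`. [cite: BrascampLieb1976, Thm 5.1 (n = 1) / Lemma 5.3] -/
theorem core (hb : 0 < b) {p : ℕ} (hp : p ≠ 0) (D : GaussQCData b G) :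
    gaussHalfMoment b 0 * ∫ x, |x| ^ p * (Real.exp (-b * x ^ 2) * G x) ≤
      gaussHalfMoment b p * ∫ x, Real.exp (-b * x ^ 2) * G x := by
  rcases D.mono_or_anti with hmono | hanti
  · exact D.core_of_mono hb hp hmono
  · have h := D.comp_neg.core_of_mono hb hp
      (fun x y hxy hy0 => hanti (by linarith) (neg_le_neg hxy))
    have e1 := integral_neg_eq_self (fun x : ℝ => |x| ^ p * (Real.exp (-b * x ^ 2) * G x)) volume
    have e2 := integral_neg_eq_self (fun x : ℝ => Real.exp (-b * x ^ 2) * G x) volume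
    simp only [abs_neg, neg_sq] at e1 e2; rwa [e1, e2] at h

end GaussQCData

end Literature.Probability.Distributions
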